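import Summits.CriticalPhenomena.PercolationContinuityZ3.Theorems.PercTiltedBlockersWideBoxToAnnulus
import HarnessLib

/-!
# `PercTiltedBlockers.TiltComparison` (stmt-CriticalPhenomena-6393): stub `stub_boxMono`

Support file for the crux `TiltComparison` of route `CriticalPhenomena/PercTiltedBlockers`
(line `birth`, registered stub `stub_boxMono`): **monotonicity of box-blocking probabilities in the
shape of the box**. For bond percolation on `ℤ³` with any parameter `p` and integers `0 ≤ h ≤ h'`,
`L' ≤ L`, any `M`,

  `P_p(R(h; L, M) blocked) ≤ P_p(R(h'; L', M) blocked)`,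

where `R(h; L, M) = [0,h] × [0,L] × [0,M] ∩ ℤ³` (`Finset.Icc 0 ![h, L, M]`, `Site 3 = Fin 3 → ℤ`
with the product order) is *blocked* when no open path inside it joins the face `{x₀ = 0}` to the
face `{x₀ = h}`: blocking bottom-to-top is easier in a TALLER and NARROWER box with the same third
side.

## The argument (Grimmett 1999, §1.6; folklore)

Deterministic core on lattice configurations `ω ⊆ E(ℤ³)` (almost sure under `P_p`,
`DCT16.real_mono_of_forall_subset_edgeSet`): an open bottom–top crossing `x → y` of `R(h'; L', M)`
(`x₀ = 0`, `y₀ = h'`), stopped at its FIRST visit to the level `{w₀ = h}`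
(`exists_openConnIn_le_level` with `f w = w₀`; along lattice edges `w₀` changes by at most one,
`zdGraph_adj_apply_le`), stays in `R(h'; L', M) ∩ {w₀ ≤ h} ⊆ R(h; L, M)` (as `L' ≤ L`), hence is an
open bottom–top crossing of `R(h; L, M)` (`openConnIn_mono`). So `Cross(h', L', M) ⊆ Cross(h, L, M)`
on lattice configurations and the complements compare the right way. Degenerate parameters
(empty boxes, `h = 0`) need no separate treatment: the inclusion of events is proved for all
integers under the three hypotheses.

No new definitions. Unconditional (no named-fact hypotheses).

## References

* G. Grimmett, *Percolation*, 2nd ed., Springer (1999), §1.6 [Grimmett1999].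
-/

noncomputable section

open MeasureTheory
open Literature.Probability.Percolation Literature.Probability.LatticeModels

namespace Summit.CriticalPhenomena.PercolationContinuityZ3.Theorems.TiltComparison

/-- Membership in the box `R(h; L, M) = Finset.Icc 0 ![h, L, M]` of `ℤ³`, coordinatewise.
[folklore] -/
theorem mem_Icc_zero_vecCons_iff (h L M : ℤ) (w : Site 3) :
    w ∈ Finset.Icc (0 : Site 3) ![h, L, M] ↔
      (0 ≤ w 0 ∧ 0 ≤ w 1 ∧ 0 ≤ w 2) ∧ (w 0 ≤ h ∧ w 1 ≤ L ∧ w 2 ≤ M) := by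
  rw [tilt_mem_Icc_iff]
  simp

/-- **A crossing of the taller, narrower box crosses the shorter, wider one** (lattice
configurations). Let `0 ≤ h ≤ h'` and `L' ≤ L`. If `ω ⊆ E(ℤ³)` has an open path inside
`R(h'; L', M)` from its bottom face `{x₀ = 0}` to its top face `{x₀ = h'}`, then — stopping that
path at its first visit to the level `{x₀ = h}` — `ω` has an open path inside `R(h; L, M)` from
`{x₀ = 0}` to `{x₀ = h}`. (Grimmett 1999, §1.6.) [folklore] -/
theorem exists_crossing_of_crossing_taller_narrower {h h' L L' M : ℤ} (h0 : 0 ≤ h) (hh : h ≤ h')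
    (hL : L' ≤ L) {ω : BondConfig (Site 3)} (hω : ω ⊆ (zdGraph 3).edgeSet)
    (hc : ∃ x ∈ Finset.Icc (0 : Site 3) ![h', L', M], ∃ y ∈ Finset.Icc (0 : Site 3) ![h', L', M],
      x 0 = 0 ∧ y 0 = h' ∧ ω ∈ openConnIn ↑(Finset.Icc (0 : Site 3) ![h', L', M]) x y) :
    ∃ x ∈ Finset.Icc (0 : Site 3) ![h, L, M], ∃ y ∈ Finset.Icc (0 : Site 3) ![h, L, M],
      x 0 = 0 ∧ y 0 = h ∧ ω ∈ openConnIn ↑(Finset.Icc (0 : Site 3) ![h, L, M]) x y := by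
  obtain ⟨x, -, y, -, hx0, hy0, hxy⟩ := hc
  obtain ⟨z, hz0, hr⟩ := exists_openConnIn_le_level (G := zdGraph 3) hω (fun w : Site 3 => w 0)
    (fun u w huw => (zdGraph_adj_apply_le huw 0).1) h (show x 0 ≤ h by omega)
    (show h ≤ y 0 by omega) hxy
  have hsub : (↑(Finset.Icc (0 : Site 3) ![h', L', M]) : Set (Site 3)) ∩ {w : Site 3 | w 0 ≤ h} ⊆
      (↑(Finset.Icc (0 : Site 3) ![h, L, M]) : Set (Site 3)) := by
    rintro w ⟨hw, hwh⟩
    rw [Finset.mem_coe, mem_Icc_zero_vecCons_iff] at hw ⊢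
    rw [Set.mem_setOf_eq] at hwh
    omega
  have hr' := openConnIn_mono hsub x z hr
  exact ⟨x, Finset.mem_coe.1 hr'.1, z, Finset.mem_coe.1 hr'.2.1, hx0, hz0, hr'⟩

/-- **Stub `stub_boxMono` of the crux `TiltComparison` (line `birth`)**: for every `p` and integer
box parameters `0 ≤ h ≤ h'`, `L' ≤ L`, any `M`, blocking `R(h; L, M)` between `x₀ = 0` and `x₀ = h`
is at most as likely as blocking the taller, narrower `R(h'; L', M)` between `x₀ = 0` and `x₀ = h'`:
`P_p(R(h; L, M) blocked) ≤ P_p(R(h'; L', M) blocked)`. On lattice configurations (a.s.,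
`DCT16.real_mono_of_forall_subset_edgeSet`) the complementary crossing events satisfy the reverse
inclusion (`exists_crossing_of_crossing_taller_narrower`). (Grimmett 1999, §1.6.) [folklore] -/
theorem stub_boxMono :
    ∀ (p : unitInterval) (h h' L L' M : ℤ), 0 ≤ h → h ≤ h' → L' ≤ L →
      (bondPercolation (zdGraph 3) p).real
          {ω | ¬ ∃ x ∈ Finset.Icc (0 : Site 3) ![h, L, M], ∃ y ∈ Finset.Icc (0 : Site 3) ![h, L, M],
            x 0 = 0 ∧ y 0 = h ∧ ω ∈ openConnIn ↑(Finset.Icc (0 : Site 3) ![h, L, M]) x y} ≤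
        (bondPercolation (zdGraph 3) p).real
          {ω | ¬ ∃ x ∈ Finset.Icc (0 : Site 3) ![h', L', M],
            ∃ y ∈ Finset.Icc (0 : Site 3) ![h', L', M],
              x 0 = 0 ∧ y 0 = h' ∧ ω ∈ openConnIn ↑(Finset.Icc (0 : Site 3) ![h', L', M]) x y} := by
  intro p h h' L L' M h0 hh hL
  exact DCT16.real_mono_of_forall_subset_edgeSet (zdGraph 3) p fun ω hω hωb hc =>
    hωb (exists_crossing_of_crossing_taller_narrower h0 hh hL hω hc)

end Summit.CriticalPhenomena.PercolationContinuityZ3.Theorems.TiltComparison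

end
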